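import Literature.LinearAlgebra.TensorNetworks.TensorCrossErrorPropagation

/-!
# Error accumulation of nested tensor cross interpolation (Savostyanov's Theorem 3)

[Savostyanov2014, §4 Thm. 3] bounds the error of the tensor-train cross interpolation formula
`Ã = T₀ P₁⁻¹ T₁ ⋯ P_n⁻¹ T_n` (`Literature.LinearAlgebra.TensorNetworks.TCIPivots.tciForm`) built on
RIGHT-NESTED column sets `J_{ℓ+1} ⊆ 𝕊_ℓ × J_{ℓ+2}` with maximal-volume crosses — the setting of
his Theorem 2 (`TCIPivots.abs_sub_tciEval_le_of_volume_maximal`) — LINEARLY in the number of legs,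
in terms of the errors `Ê_k` of the matrix cross interpolations of the FULL unfoldings `A^{(k)}` on
the same crosses `(I^{≤k}, J^{>k})` [Savostyanov2014, §4 (eq. ihat)]:
`A(i) = Σ_{s,t} A(i_{≤k}, J^{>k}_t) B^{[k]}_{t s} A(I^{≤k}_s, i_{>k}) + Ê_k(i)`, `B^{[k]} = A_k⁻¹`.
THEOREM 3: if `|Ê_k| ≤ ε̂ |A|` for every inner bond then
`|A - Ã| ≤ d r ε̂ / (1 - d r κ ε̂) · |A|`, `κ = max_k r_k |A| |A_k⁻¹|` the Chebyshev "condition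
numbers" of [Savostyanov2014, (eq1) and Remark 1], provided the denominator is positive.  Its proof
expands `A - Ã` from LEFT TO RIGHT: `A = Φ_0`, `Ã = Φ_{d-1}`, where `Φ_k` is the train up to bond
`k` completed by the exact rows `A(I^{≤k}, i_{>k})`, and
`Φ_{k-1} - Φ_k = Σ_u (T₀ B^{[1]} ⋯ T_{k-1} B^{[k]})_u · Ê_k(I^{≤k-1}_· i_k ; i_{>k})`; the row
vector in front of `Ê_k` is controlled WITHOUT exponential amplification by Lemma 3
(right-nestedness: the partial train `T₀ B^{[1]} ⋯ T_{k-1}` is `Ã` on the subtensor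
`A(i_{<k}, J^{>k-1})`, hence `= A - Δ` there) and the ROW dominance of the maximal-volume
submatrix `A_k` (`|A(i_{≤k}, J^{>k}) A_k⁻¹| ≤ 1`), giving `|Δ| ≤ d r ε̂ |A| + d r κ ε̂ |Δ|`.

DICTIONARY (as in `TensorCrossErrorPropagation`).  Legs `0, …, n` of `p : TCIPivots σ` are
Savostyanov's `1, …, d`, `d = n + 1`; bond `ℓ` (legs `< ℓ` | legs `≥ ℓ`) is his `k = ℓ`,
`p.row ℓ = I^{≤ℓ}`, `p.col ℓ = J^{>ℓ}`, `P_ℓ = A_ℓ`, `leftProd s k = T₀^{s 0} P₁⁻¹ ⋯ T_{k-1} P_k⁻¹`;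
`hatErr ℓ i j = Ê_ℓ(i; j)` is the entry `(i, j)` of `U - crossInterp U I_ℓ J_{ℓ+1}` for the
unfolding kernel `U (i, j) = A(i ⊕ j)`; `fwdVal s k = Φ_k(s)`.  This file formalises, over a
commutative ring (identities), a normed field (bounds) and `ℝ` (Theorem 3 itself):

* `TCIPivots.hatErr`, `hatErr_apply`, `hatErr_pivotRow`, `hatErr_pivotCol`, `bondErr_eq_hatErr` —
  the full-unfolding cross errors `Ê_ℓ` of (eq. ihat); they vanish on the cross, and the local
  errors `E_ℓ` of Theorem 2 (`bondErr`) are their values on the columns `𝕊_ℓ × J_{ℓ+2}`;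
* `fwdVal`, `fwdVal_zero` (`Φ_0 = A`), `fwdVal_last` (`Φ_n = Ã`), `fwdVal_sub_fwdVal_succ` — ONE
  LEFT-TO-RIGHT INTERPOLATION STEP `Φ_k - Φ_{k+1} = Σ_u (leftProd k)_u Ê_{k+1}(I_k^u s_k ; s_{>k})`,
  and `sub_tciEval_eq_sum_leftProd_mul_hatErr` — THE ERROR EXPANSION
  `A(s) - Ã(s) = Σ_{k<n} Σ_u (T₀ P₁⁻¹ ⋯ P_k⁻¹)_u · Ê_{k+1}(row k u ⊕ s k ; s (k+1) … s n)`, an exact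
  identity for ARBITRARY pivots (no nesting, no maximality, any commutative ring);
* `sum_mul_inv_pivMat_mul_det` (Cramer form of the row coefficients `A(i, J^{>ℓ}) A_ℓ⁻¹`, via
  `Literature.LinearAlgebra.Matrix.mul_inv_submatrix_apply_mul_det`),
  `norm_sum_mul_inv_pivMat_le_of_det_exchange_le` — ROW DOMINANCE: if exchanging a pivot row for
  the row `i` multiplies `‖det P_ℓ‖` by at most `c` then `‖A(i, J^{>ℓ}) A_ℓ⁻¹‖ ≤ c`
  [Savostyanov2014, §2 and §4, proof of Thm. 3];
* `leftProd_succ_apply_eq_sum_tciEval_mul` — Lemma 3 read on the left factor: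
  under right-nesting from bond `k+1` on, `(T₀ P₁⁻¹ ⋯ T_k P_{k+1}⁻¹)_u = Σ_y Ã(s_{≤k} ⊕ J_{k+2}^y)
  (P_{k+1}⁻¹)_{y u}` ("we replace the piece of the interpolation train with the subtensor");
  `norm_leftProd_succ_apply_le` — hence `‖(T₀ P₁⁻¹ ⋯ P_{k+1}⁻¹)_u‖ ≤ c + χ_{k+1} β_{k+1} M` with
  `β_ℓ ≥ |P_ℓ⁻¹|`, `M ≥ sup |A - Ã|`; `norm_leftProd_zero_apply`;
* `norm_sub_tciEval_le_sum_of_leftProd_le` — the first-order structure of the bound,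
  `‖A(s) - Ã(s)‖ ≤ Σ_{k<n} χ_k Λ_k η_{k+1}` from `‖leftProd k‖ ≤ Λ_k`, `‖Ê_{k+1}‖ ≤ η_{k+1}`;
  `norm_sub_tciEval_le_of_rowDominant` — the IMPLICIT BOUND of the proof of Theorem 3,
  `‖A(s) - Ã(s)‖ ≤ n r (c η + τ M)` for `χ_ℓ ≤ r`, `‖Ê_ℓ‖ ≤ η`, `χ_ℓ β_ℓ η ≤ τ`, `c`-row-dominant
  nonsingular `P_ℓ` and right-nested columns (any normed field);
* `submatrix_unfoldingKernel_update_row_eq` — with nesting witnesses the row exchanges of `P_ℓ`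
  live inside the sub-unfolding `[A(i_{<ℓ} ; 𝕊_ℓ × J_{ℓ+2})]` in which Theorem 2 asks `P_ℓ` to
  have maximal volume, so maximal volume gives row dominance with `c = 1`; `tciEval_congr`;
* `abs_sub_tciEval_le_of_volume_maximal_of_hatErr_le` — THEOREM 3 for real tensors with finitely
  many leg values: under the hypotheses of Theorem 2 (right-nested columns with witnesses,
  `P_ℓ` nonsingular and of maximal volume in the sub-unfolding of bond `ℓ`, `χ_ℓ ≤ r`, `1 ≤ ℓ ≤ n`)
  and `|Ê_ℓ| ≤ η` on the unfoldings, `|P_ℓ⁻¹| ≤ β_ℓ`, `χ_ℓ β_ℓ η ≤ τ`, `n r τ < 1`: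
  `|A(s) - Ã(s)| ≤ n r η / (1 - n r τ)` at every configuration (the supremum `M` of the error is
  attained since the configurations of the `n+1` legs form a finite set, and `M ≤ n r η + n r τ M`);
  `abs_sub_tciEval_le_of_volume_maximal_of_hatErr_le_rel` — the printed relative form
  `|A - Ã| ≤ (d-1) r ε̂ / (1 - (d-1) r κ ε̂) · |A|` with `η = ε̂ |A|`, `χ_ℓ |A| β_ℓ ≤ κ`, and
  `abs_sub_tciEval_le_of_volume_maximal_of_hatErr_le_rel'` — literally (eq3) with the printed
  coefficient `d = n + 1` (which dominates the `d - 1` obtained by counting the `n` inner bonds).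

The expansion and the `Λ_k / η_k` bound are stated for arbitrary pivots on purpose: they are the
form in which a-posteriori estimates of the full-unfolding cross errors `Ê_k` (e.g. from held-out
samples of the unfoldings) translate into an error bound for the assembled train, linearly in the
number of bonds as long as the left factors stay bounded — Savostyanov's remark that (eq3) "is
useful in special cases when the theoretical or numerical estimates available for the errors
`|Ê_k|` are bounded or grow moderately with `d`".

NOT formalised: Theorem 1 (balanced dimension tree, coefficient `(2r + κ r + 1)^{⌈log₂ d⌉}`) and
Lemma 2 (two-sided perturbation of the interpolation formula), the Frobenius-norm statements, any
a-priori bound on `|Ê_k|` (the paper stresses that none is available in general), the QTT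
discussion of §5, and the existence or computation of maximal-volume / nested pivots (maxvol,
DMRG / ALS / greedy cross algorithms [DolgovSavostyanov2020, §3.3]) — the hypotheses record the
outcome of such a search, not an algorithm.

References: D. V. Savostyanov, *Quasioptimality of maximum-volume cross interpolation of
tensors*, Linear Algebra Appl. 458 (2014) 217–244 (arXiv:1305.1818; numbering of the arXiv
version): §2 (dominance), §3 (eq1) and Remark 1 (`κ`), §4 Lemma 3, (eq. ihat), Theorem 3 and its
proof; S. Dolgov, D. Savostyanov, *Parallel cross interpolation for high-precision calculation of
high-dimensional integrals*, Comput. Phys. Commun. 246 (2020) 106869 (arXiv:1903.11554), §3.1–3.2;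
Y. Núñez Fernández et al., *Learning tensor networks with tensor cross interpolation: new
algorithms and libraries*, SciPost Phys. 18 (2025) 104 (arXiv:2407.02454), §3.1, §4.1–4.2 (pivot
error estimates from samples of the unfoldings).
AI-produced formalisation (H21 engines group, seat eng-quad-2, 2026-08-21); no facts, no axioms
beyond Mathlib's, no `sorry`.
-/

open Matrix Finset

namespace Literature.LinearAlgebra.TensorNetworks

section Config

variable {σ : Type*}

/-- [folklore] -/
@[simp] private theorem pfx_zero₃ (s : ℕ → σ) : pfx s 0 = [] := rfl

/-- [folklore] -/
private theorem pfx_succ₃ (s : ℕ → σ) (k : ℕ) : pfx s (k + 1) = pfx s k ++ [s k] := rfl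

/-- [folklore] -/
@[simp] private theorem sfx_zero₃ (s : ℕ → σ) (k : ℕ) : sfx s k 0 = [] := rfl

/-- [folklore] -/
private theorem sfx_succ₃ (s : ℕ → σ) (k m : ℕ) : sfx s k (m + 1) = s k :: sfx s (k + 1) m := rfl

/-- [folklore] -/
private theorem length_pfx₃ (s : ℕ → σ) : ∀ k, (pfx s k).length = k
  | 0 => rfl
  | k + 1 => by simp [pfx_succ₃, length_pfx₃ s k]

/-- [folklore] -/
private theorem length_sfx₃ (s : ℕ → σ) : ∀ m k, (sfx s k m).length = m
  | 0, _ => rfl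
  | m + 1, k => by simp [sfx_succ₃, length_sfx₃ s m (k + 1)]

/-- [folklore] -/
private theorem sfx_succ_right₃ (s : ℕ → σ) (k m : ℕ) :
    sfx s k (m + 1) = sfx s k m ++ [s (k + m)] := by
  induction m generalizing k with
  | zero => simp [sfx_succ₃]
  | succ m ih =>
      rw [sfx_succ₃, ih (k + 1), sfx_succ₃, List.cons_append,
        show k + 1 + m = k + (m + 1) by omega]

/-- [folklore] -/
private theorem pfx_add₃ (s : ℕ → σ) (k m : ℕ) : pfx s (k + m) = pfx s k ++ sfx s k m := by
  induction m with
  | zero => simp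
  | succ m ih => rw [← Nat.add_assoc, pfx_succ₃, ih, sfx_succ_right₃, List.append_assoc]

/-- [folklore] -/
private theorem pfx_eq_sfx_zero (s : ℕ → σ) (m : ℕ) : pfx s m = sfx s 0 m := by
  have h := pfx_add₃ s 0 m
  simpa using h

/-- [folklore] -/
private theorem pfx_congr₃ {s s' : ℕ → σ} : ∀ k, (∀ j < k, s j = s' j) → pfx s k = pfx s' k
  | 0, _ => rfl
  | k + 1, h => by
      rw [pfx_succ₃, pfx_succ₃, pfx_congr₃ k fun j hj => h j (Nat.lt_succ_of_lt hj),
        h k (Nat.lt_succ_self k)]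

/-- A sequence whose window of length `l.length` starting at leg `a` reads the list `l`.
[folklore] -/
private theorem sfx_eq_of_getD (e : ℕ → σ) (d : σ) :
    ∀ (l : List σ) (a : ℕ), (∀ t, e (a + t) = l.getD t d) → sfx e a l.length = l
  | [], _, _ => rfl
  | x :: l, a, h => by
      rw [List.length_cons, sfx_succ₃]
      congr 1
      · simpa using h 0
      · refine sfx_eq_of_getD e d l (a + 1) fun t => ?_
        rw [show a + 1 + t = a + (t + 1) by omega, h (t + 1)]
        simp

/-- The index sequence read off a configuration of finitely many legs (padded with `d`).
[folklore] -/
private def extSeq {m : ℕ} (d : σ) (v : Fin m → σ) : ℕ → σ :=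
  fun j => if h : j < m then v ⟨j, h⟩ else d

/-- [folklore] -/
private theorem extSeq_restrict {m : ℕ} (d : σ) (s : ℕ → σ) {j : ℕ} (hj : j < m) :
    extSeq d (fun i : Fin m => s i) j = s j := by
  simp [extSeq, hj]

end Config

namespace TCIPivots

variable {σ : Type*} (p : TCIPivots σ)

/-- [folklore] -/
private theorem eq_rowZero (u : Fin (p.χ 0)) : u = p.rowZero := by
  have h : (u : ℕ) < p.χ 0 := u.isLt
  have h0 : p.χ 0 = 1 := p.χ_zero
  have hu : (u : ℕ) = 0 := by omega
  have hz : ((p.rowZero : Fin (p.χ 0)) : ℕ) < p.χ 0 := p.rowZero.isLt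
  exact Fin.ext (by omega)

section CommRing

variable {K : Type*} [CommRing K] (F : List σ → K)

/-! ### The full-unfolding cross errors `Ê_ℓ` -/

/-- THE FULL-UNFOLDING CROSS ERROR of bond `ℓ`, Savostyanov's `Ê_ℓ` (eq. ihat): for a row
multi-index `i` (legs `< ℓ`) and a column multi-index `j` (legs `≥ ℓ`),
`Ê_ℓ(i; j) = A(i ⊕ j) - Σ_{t,u} A(i ⊕ J^{>ℓ}_t) (A_ℓ⁻¹)_{t u} A(I^{≤ℓ}_u ⊕ j)` — the entry `(i, j)`
of the error of the matrix cross interpolation (`Literature.LinearAlgebra.Matrix.crossInterp`)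
of the whole `ℓ`-th unfolding kernel on the cross `(I_ℓ, J_{ℓ+1})`.
[cite: Savostyanov2014, §4 eq. (ihat) before Thm. 3][cite: NunezFernandezEtAl2025, §3.1] -/
noncomputable def hatErr (ℓ : ℕ) (i j : List σ) : K :=
  (unfoldingKernel F -
    Literature.LinearAlgebra.Matrix.crossInterp (unfoldingKernel F) (p.row ℓ) (p.col ℓ)) i j

/-- Entries of the full-unfolding cross error:
`Ê_ℓ(i; j) = A(i ⊕ j) - Σ_u Σ_t A(i ⊕ col ℓ t) (P_ℓ⁻¹)_{t u} A(row ℓ u ⊕ j)`.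
[cite: Savostyanov2014, §4 eq. (ihat) before Thm. 3] -/
theorem hatErr_apply (ℓ : ℕ) (i j : List σ) :
    p.hatErr F ℓ i j =
      F (i ++ j) - ∑ u, ∑ t, F (i ++ p.col ℓ t) * (p.pivMat F ℓ)⁻¹ t u * F (p.row ℓ u ++ j) := by
  rw [hatErr, Literature.LinearAlgebra.Matrix.crossInterp,
    ← p.pivMat_eq_submatrix_unfoldingKernel F ℓ]
  simp only [Matrix.sub_apply, Matrix.mul_apply, Matrix.submatrix_apply, id_eq,
    unfoldingKernel_apply, Finset.sum_mul]

/-- `Ê_ℓ` vanishes on the pivot rows `I_ℓ`.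
[cite: Savostyanov2014, §2][cite: NunezFernandezEtAl2025, §3.1 property (ii)] -/
theorem hatErr_pivotRow {ℓ : ℕ} (hP : IsUnit (p.pivMat F ℓ).det) (x : Fin (p.χ ℓ))
    (j : List σ) : p.hatErr F ℓ (p.row ℓ x) j = 0 := by
  have hP' : IsUnit ((unfoldingKernel F).submatrix (p.row ℓ) (p.col ℓ)).det := by
    rw [← pivMat_eq_submatrix_unfoldingKernel]; exact hP
  rw [hatErr, Matrix.sub_apply,
    Literature.LinearAlgebra.Matrix.crossInterp_apply_pivotRow _ hP' x j, sub_self]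

/-- `Ê_ℓ` vanishes on the pivot columns `J_{ℓ+1}`.
[cite: Savostyanov2014, §2][cite: NunezFernandezEtAl2025, §3.1 property (ii)] -/
theorem hatErr_pivotCol {ℓ : ℕ} (hP : IsUnit (p.pivMat F ℓ).det) (i : List σ)
    (y : Fin (p.χ ℓ)) : p.hatErr F ℓ i (p.col ℓ y) = 0 := by
  have hP' : IsUnit ((unfoldingKernel F).submatrix (p.row ℓ) (p.col ℓ)).det := by
    rw [← pivMat_eq_submatrix_unfoldingKernel]; exact hP
  rw [hatErr, Matrix.sub_apply,
    Literature.LinearAlgebra.Matrix.crossInterp_apply_pivotCol _ hP' i y, sub_self]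

/-- The local error `E_ℓ` of Theorem 2 is the full-unfolding error `Ê_ℓ` on the columns
`𝕊_ℓ × J_{ℓ+2}`: `E_ℓ(i; a, y') = Ê_ℓ(i; a ⊕ col (ℓ+1) y')` (the maximal-volume estimate of
Theorem 2 controls `Ê_ℓ` on this subtensor only; Theorem 3 assumes a bound on all of `Ê_ℓ`).
[cite: Savostyanov2014, §4, paragraph before eq. (ihat)] -/
theorem bondErr_eq_hatErr (ℓ : ℕ) (i : List σ) (a : σ) (y' : Fin (p.χ (ℓ + 1))) :
    p.bondErr F ℓ i a y' = p.hatErr F ℓ i (a :: p.col (ℓ + 1) y') :=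
  p.bondErr_eq_sub_crossInterp F ℓ i a y'

/-! ### The left-to-right expansion of the error -/

/-- `Φ_k(s) = Σ_u (T₀^{s 0} P₁⁻¹ ⋯ T_{k-1}^{s (k-1)} P_k⁻¹)_u · A(row k u ⊕ s k ⋯ s n)`: the train
up to bond `k` completed by the EXACT rows `A(I^{≤k}, i_{>k})` of the tensor (the `k`-th stage of
the left-to-right expansion in the proof of Theorem 3; `Φ_0 = A`, `Φ_n = Ã`).
[cite: Savostyanov2014, §4, proof of Thm. 3] -/
noncomputable def fwdVal (s : ℕ → σ) (k : ℕ) : K :=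
  ∑ u, p.leftProd F s k p.rowZero u * F (p.row k u ++ sfx s k (p.n + 1 - k))

/-- `Φ_0(s) = A(s)`.  [cite: Savostyanov2014, §4, proof of Thm. 3] -/
theorem fwdVal_zero (s : ℕ → σ) : p.fwdVal F s 0 = F (pfx s (p.n + 1)) := by
  have h0 : p.row 0 p.rowZero = [] := List.eq_nil_of_length_eq_zero (p.length_row 0 _)
  rw [fwdVal, Fintype.sum_eq_single p.rowZero (fun u hu => absurd (p.eq_rowZero u) hu),
    pfx_eq_sfx_zero]
  simp [leftProd, h0]

/-- `Φ_n(s) = Ã(s)`: at the last bond the completed train is the TCI form itself.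
[cite: Savostyanov2014, §4, proof of Thm. 3] -/
theorem fwdVal_last (s : ℕ → σ) : p.fwdVal F s p.n = p.tciEval F s := by
  have hcol : p.col (p.n + 1) p.colLast = [] :=
    List.eq_nil_of_length_eq_zero (by simp [p.length_col])
  have h1 : sfx s p.n (p.n + 1 - p.n) = [s p.n] := by rw [Nat.add_sub_cancel_left]; rfl
  rw [fwdVal, p.tciEval_eq_tciForm F s p.rowZero p.colLast, tciForm_eq_lvlForm, lvlForm,
    Matrix.mul_apply]
  simp only [siteMat_apply, hcol, h1]

/-- ONE LEFT-TO-RIGHT INTERPOLATION STEP: for `k ≤ n`,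
`Φ_k(s) - Φ_{k+1}(s) = Σ_u (T₀ P₁⁻¹ ⋯ P_k⁻¹)_u · Ê_{k+1}(row k u ⊕ s k ; s (k+1) ⋯ s n)` —
interpolating the rows `A(I^{≤k} ⊕ i_k, i_{>k})` of bond `k+1` by the cross `(I_{k+1}, J_{k+2})`
costs exactly the full-unfolding error `Ê_{k+1}` weighted by the left factor.  An identity for
arbitrary pivots over any commutative ring.
[cite: Savostyanov2014, §4, proof of Thm. 3] -/
theorem fwdVal_sub_fwdVal_succ (s : ℕ → σ) {k : ℕ} (hk : k ≤ p.n) :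
    p.fwdVal F s k - p.fwdVal F s (k + 1) =
      ∑ u, p.leftProd F s k p.rowZero u *
        p.hatErr F (k + 1) (p.row k u ++ [s k]) (sfx s (k + 1) (p.n - k)) := by
  have hsfx : sfx s k (p.n + 1 - k) = s k :: sfx s (k + 1) (p.n - k) := by
    rw [show p.n + 1 - k = (p.n - k) + 1 by omega, sfx_succ₃]
  have hk' : p.n + 1 - (k + 1) = p.n - k := by omega
  simp only [fwdVal, hsfx, hk', hatErr_apply, leftProd_succ, Matrix.mul_apply, siteMat_apply,
    List.append_assoc, List.singleton_append, mul_sub, Finset.sum_sub_distrib]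
  congr 1
  simp only [Finset.mul_sum, Finset.sum_mul, mul_assoc]
  exact Finset.sum_comm

/-- THE ERROR EXPANSION of the proof of Theorem 3:
`A(s) - Ã(s) = Σ_{k<n} Σ_u (T₀^{s 0} P₁⁻¹ ⋯ T_{k-1}^{s (k-1)} P_k⁻¹)_u ·
Ê_{k+1}(row k u ⊕ s k ; s (k+1) ⋯ s n)` — the interpolation error is the sum over the inner bonds
of the full-unfolding cross errors at the rows `I^{≤k} ⊕ 𝕊_k` met by the configuration, weighted
by the left partial products.  An identity for arbitrary pivots over any commutative ring (for
`k = 0` the weight is `1` and the term is `Ê_1(s)`).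
[cite: Savostyanov2014, §4, proof of Thm. 3] -/
theorem sub_tciEval_eq_sum_leftProd_mul_hatErr (s : ℕ → σ) :
    F (pfx s (p.n + 1)) - p.tciEval F s =
      ∑ k ∈ Finset.range p.n, ∑ u, p.leftProd F s k p.rowZero u *
        p.hatErr F (k + 1) (p.row k u ++ [s k]) (sfx s (k + 1) (p.n - k)) := by
  rw [← p.fwdVal_zero F s, ← p.fwdVal_last F s, ← Finset.sum_range_sub' (p.fwdVal F s) p.n]
  exact Finset.sum_congr rfl fun k hk => p.fwdVal_sub_fwdVal_succ F s (Finset.mem_range.mp hk).le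

/-! ### The left factors: Cramer form, Lemma 3, configurations -/

/-- CRAMER FORM OF THE ROW COEFFICIENTS: `(Σ_y A(i ⊕ col ℓ y) (P_ℓ⁻¹)_{y u}) · det P_ℓ` is the
determinant of the pivot matrix with its `u`-th row replaced by the row `A(i, J_{ℓ+1})`.
[cite: Savostyanov2014, §2][cite: HornJohnson2013, §0.8.3] -/
theorem sum_mul_inv_pivMat_mul_det {ℓ : ℕ} (hP : IsUnit (p.pivMat F ℓ).det) (i : List σ)
    (u : Fin (p.χ ℓ)) :
    (∑ y, F (i ++ p.col ℓ y) * (p.pivMat F ℓ)⁻¹ y u) * (p.pivMat F ℓ).det =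
      ((unfoldingKernel F).submatrix (Function.update (p.row ℓ) u i) (p.col ℓ)).det := by
  have hR : ((unfoldingKernel F).submatrix id (p.col ℓ)).submatrix (p.row ℓ) id = p.pivMat F ℓ :=
    rfl
  have hP' : IsUnit (((unfoldingKernel F).submatrix id (p.col ℓ)).submatrix (p.row ℓ) id).det := by
    rw [hR]; exact hP
  have h := Literature.LinearAlgebra.Matrix.mul_inv_submatrix_apply_mul_det
    ((unfoldingKernel F).submatrix id (p.col ℓ)) (p.row ℓ) hP' i u
  rw [hR] at h
  have hsum : ((unfoldingKernel F).submatrix id (p.col ℓ) * (p.pivMat F ℓ)⁻¹) i u =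
      ∑ y, F (i ++ p.col ℓ y) * (p.pivMat F ℓ)⁻¹ y u := by
    simp only [Matrix.mul_apply, Matrix.submatrix_apply, id_eq, unfoldingKernel_apply]
  rw [hsum] at h
  rw [h]
  rfl

/-- The TCI value depends only on the indices `s 0, …, s n` of the legs.
[cite: NunezFernandezEtAl2025, §4.1] -/
theorem tciEval_congr {s s' : ℕ → σ} (h : ∀ j ≤ p.n, s j = s' j) :
    p.tciEval F s = p.tciEval F s' := by
  rw [p.tciEval_eq_tciForm F s p.rowZero p.colLast, p.tciEval_eq_tciForm F s' p.rowZero p.colLast,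
    tciForm_eq_lvlForm, tciForm_eq_lvlForm, lvlForm, lvlForm,
    p.leftProd_congr F p.n fun j hj => h j hj.le, h p.n le_rfl]

/-- LEMMA 3 ON THE LEFT FACTOR ("replace the piece of the interpolation train with the
subtensor"): if the column pivots are right-nested from bond `k+1` on and the pivot matrices are
nonsingular, then for any configurations `e y` (`y ∈ J_{k+2}`) that agree with `s` on the legs
`≤ k` and continue with the column pivot `col (k+1) y`,
`(T₀^{s 0} P₁⁻¹ ⋯ T_k^{s k} P_{k+1}⁻¹)_u = Σ_y Ã(e y) · (P_{k+1}⁻¹)_{y u}`.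
[cite: Savostyanov2014, §4 Lemma 3 and proof of Thm. 3] -/
theorem leftProd_succ_apply_eq_sum_tciEval_mul (s : ℕ → σ)
    (hP : ∀ ℓ, 1 ≤ ℓ → ℓ ≤ p.n → IsUnit (p.pivMat F ℓ).det) {k : ℕ} (hk : k ≤ p.n)
    (hJ : ∀ ℓ, k + 1 ≤ ℓ → ℓ ≤ p.n → p.ColNested ℓ) (e : Fin (p.χ (k + 1)) → ℕ → σ)
    (he : ∀ y, ∀ j ≤ k, e y j = s j)
    (hey : ∀ y, p.col (k + 1) y = sfx (e y) (k + 1) (p.n - k)) (u : Fin (p.χ (k + 1))) :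
    p.leftProd F s (k + 1) p.rowZero u =
      ∑ y, p.tciEval F (e y) * (p.pivMat F (k + 1))⁻¹ y u := by
  rw [leftProd_succ, ← Matrix.mul_assoc, Matrix.mul_apply]
  refine Finset.sum_congr rfl fun y _ => ?_
  congr 1
  rw [p.tciEval_eq_tciForm F (e y) p.rowZero p.colLast,
    p.tciForm_apply_eq_lvlForm_of_colNested F (e y) hP hk hJ (hey y) p.rowZero p.colLast, lvlForm,
    p.leftProd_congr F k (fun j hj => (he y j hj.le).symm), he y k le_rfl]

/-- A configuration agreeing with `s` on the legs `≤ k` and continuing with `col (k+1) y` reads,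
on the legs `0, …, n`, the multi-index `(s 0, …, s k) ⊕ col (k+1) y`.  [folklore] -/
private theorem pfx_ext_eq (s e : ℕ → σ) {k : ℕ} (hk : k ≤ p.n) (he : ∀ j ≤ k, e j = s j)
    {y : Fin (p.χ (k + 1))} (hey : p.col (k + 1) y = sfx e (k + 1) (p.n - k)) :
    pfx e (p.n + 1) = pfx s (k + 1) ++ p.col (k + 1) y := by
  rw [hey, show p.n + 1 = (k + 1) + (p.n - k) by omega, pfx_add₃,
    pfx_congr₃ (k + 1) fun j hj => he j (Nat.lt_succ_iff.mp hj)]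

/-- Such configurations exist (extend `(s 0, …, s k)` by the letters of `col (k+1) y`).
[folklore] -/
private theorem exists_ext (s : ℕ → σ) (k : ℕ) (y : Fin (p.χ (k + 1))) (hk : k ≤ p.n) :
    ∃ e : ℕ → σ, (∀ j ≤ k, e j = s j) ∧ p.col (k + 1) y = sfx e (k + 1) (p.n - k) := by
  have hlen : (p.col (k + 1) y).length = p.n - k := by rw [p.length_col]; omega
  have key : ∀ e : ℕ → σ, (∀ t, e (k + 1 + t) = (p.col (k + 1) y).getD t (s 0)) →
      p.col (k + 1) y = sfx e (k + 1) (p.n - k) := fun e he => by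
    rw [← hlen]; exact (sfx_eq_of_getD e (s 0) _ (k + 1) he).symm
  refine ⟨fun j => if j < k + 1 then s j else (p.col (k + 1) y).getD (j - (k + 1)) (s 0),
    fun j hj => if_pos (Nat.lt_succ_of_le hj), key _ fun t => ?_⟩
  show (if k + 1 + t < k + 1 then s (k + 1 + t) else (p.col (k + 1) y).getD (k + 1 + t - (k + 1)) (s 0)) = _
  rw [if_neg (show ¬ (k + 1 + t < k + 1) by omega), Nat.add_sub_cancel_left]

omit [CommRing K] in
/-- With nesting witnesses `c` (`col ℓ t = (c t).1 ⊕ col (ℓ+1) (c t).2`), exchanging the `u`-th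
pivot ROW of `P_ℓ` for a row multi-index `i` inside the unfolding kernel is the same matrix as
exchanging the `u`-th row index for `i` inside the sub-unfolding `[A(i_{<ℓ} ; 𝕊_ℓ × J_{ℓ+2})]` — so
maximal volume of `P_ℓ` in the sub-unfolding (the hypothesis of Theorem 2) yields the ROW
dominance used in the proof of Theorem 3.  [cite: Savostyanov2014, §2 and §4, proof of Thm. 3] -/
theorem submatrix_unfoldingKernel_update_row_eq {ℓ : ℕ}
    {c : Fin (p.χ ℓ) → σ × Fin (p.χ (ℓ + 1))}
    (hc : ∀ t, p.col ℓ t = (c t).1 :: p.col (ℓ + 1) (c t).2) (u : Fin (p.χ ℓ))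
    (i : List σ) (hi : i.length = ℓ) :
    (unfoldingKernel F).submatrix (Function.update (p.row ℓ) u i) (p.col ℓ) =
      (p.subUnfolding F ℓ).submatrix (Function.update (p.rowVec ℓ) u ⟨i, hi⟩) c := by
  ext v t
  simp only [Matrix.submatrix_apply, unfoldingKernel_apply, subUnfolding_apply]
  rw [Function.update_apply, Function.update_apply]
  split_ifs with h
  · simp [hc t]
  · simp [hc t, rowVec]

end CommRing

/-! ### Norm bounds -/

section Normed

variable {𝕜 : Type*} [NormedField 𝕜] (F : List σ → 𝕜)

/-- ROW DOMINANCE BOUNDS THE ROW COEFFICIENTS: if `P_ℓ` is nonsingular and exchanging any one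
of its rows for the row `A(i, J_{ℓ+1})` multiplies `‖det‖` by at most `c`, then
`‖Σ_y A(i ⊕ col ℓ y) (P_ℓ⁻¹)_{y u}‖ ≤ c` for every `u` (`c = 1`: the dominance
`|A(i_{≤ℓ}, J^{>ℓ}) A_ℓ⁻¹| ≤ 1` of a maximal-volume submatrix in its rows).
[cite: Savostyanov2014, §2 and §4, proof of Thm. 3][cite: AllenLaiShen2024, Lemma 1] -/
theorem norm_sum_mul_inv_pivMat_le_of_det_exchange_le {ℓ : ℕ}
    (hP : IsUnit (p.pivMat F ℓ).det) {c : ℝ} {i : List σ}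
    (hdom : ∀ u : Fin (p.χ ℓ),
      ‖((unfoldingKernel F).submatrix (Function.update (p.row ℓ) u i) (p.col ℓ)).det‖ ≤
        c * ‖(p.pivMat F ℓ).det‖)
    (u : Fin (p.χ ℓ)) : ‖∑ y, F (i ++ p.col ℓ y) * (p.pivMat F ℓ)⁻¹ y u‖ ≤ c := by
  have hdet : 0 < ‖(p.pivMat F ℓ).det‖ := norm_pos_iff.mpr hP.ne_zero
  have key : ‖∑ y, F (i ++ p.col ℓ y) * (p.pivMat F ℓ)⁻¹ y u‖ * ‖(p.pivMat F ℓ).det‖ ≤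
      c * ‖(p.pivMat F ℓ).det‖ := by
    rw [← norm_mul, p.sum_mul_inv_pivMat_mul_det F hP i u]
    exact hdom u
  exact le_of_mul_le_mul_right key hdet

/-- The left factor at bond `0` is the `1 × 1` identity: `‖(leftProd 0)_u‖ = 1`.
[cite: NunezFernandezEtAl2025, §4.1] -/
theorem norm_leftProd_zero_apply (s : ℕ → σ) (u : Fin (p.χ 0)) :
    ‖p.leftProd F s 0 p.rowZero u‖ = 1 := by
  rw [p.eq_rowZero u]
  simp [leftProd]

/-- BOUND ON THE LEFT FACTOR WITHOUT EXPONENTIAL AMPLIFICATION: if the column pivots are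
right-nested from bond `k+1` on, the inner pivot matrices are nonsingular, `P_{k+1}` is
`c`-row-dominant (exchanging a pivot row for any row multi-index of length `k+1` multiplies
`‖det P_{k+1}‖` by at most `c`), `‖(P_{k+1}⁻¹)_{y u}‖ ≤ β` and the interpolation error is `≤ M`
EVERYWHERE, then `‖(T₀^{s 0} P₁⁻¹ ⋯ T_k^{s k} P_{k+1}⁻¹)_u‖ ≤ c + χ_{k+1} β M`: by Lemma 3 the
factor is
`Σ_y Ã(s_{≤k} ⊕ J^y) (P⁻¹)_{y u} = Σ_y A(s_{≤k} ⊕ J^y) (P⁻¹)_{y u} - Σ_y Δ(⋯) (P⁻¹)_{y u}`,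
the first sum being `≤ c` by row dominance.
[cite: Savostyanov2014, §4, proof of Thm. 3] -/
theorem norm_leftProd_succ_apply_le (s : ℕ → σ)
    (hP : ∀ ℓ, 1 ≤ ℓ → ℓ ≤ p.n → IsUnit (p.pivMat F ℓ).det) {k : ℕ} (hk : k + 1 ≤ p.n)
    (hJ : ∀ ℓ, k + 1 ≤ ℓ → ℓ ≤ p.n → p.ColNested ℓ) {c β M : ℝ}
    (hdom : ∀ i : List σ, i.length = k + 1 → ∀ u : Fin (p.χ (k + 1)),
      ‖((unfoldingKernel F).submatrix (Function.update (p.row (k + 1)) u i)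
          (p.col (k + 1))).det‖ ≤ c * ‖(p.pivMat F (k + 1)).det‖)
    (hβ : ∀ y u, ‖(p.pivMat F (k + 1))⁻¹ y u‖ ≤ β)
    (hM : ∀ s' : ℕ → σ, ‖F (pfx s' (p.n + 1)) - p.tciEval F s'‖ ≤ M) (u : Fin (p.χ (k + 1))) :
    ‖p.leftProd F s (k + 1) p.rowZero u‖ ≤ c + p.χ (k + 1) * (β * M) := by
  have hk' : k ≤ p.n := Nat.le_of_succ_le hk
  choose e he hey using fun y : Fin (p.χ (k + 1)) => p.exists_ext s k y hk'
  rw [p.leftProd_succ_apply_eq_sum_tciEval_mul F s hP hk' hJ e he hey u]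
  have hsum : ∑ y, p.tciEval F (e y) * (p.pivMat F (k + 1))⁻¹ y u =
      ∑ y, F (pfx s (k + 1) ++ p.col (k + 1) y) * (p.pivMat F (k + 1))⁻¹ y u -
        ∑ y, (F (pfx (e y) (p.n + 1)) - p.tciEval F (e y)) * (p.pivMat F (k + 1))⁻¹ y u := by
    rw [← Finset.sum_sub_distrib]
    refine Finset.sum_congr rfl fun y _ => ?_
    rw [p.pfx_ext_eq s (e y) hk' (he y) (hey y)]
    ring
  rw [hsum]
  refine (norm_sub_le _ _).trans (add_le_add ?_ ?_)
  · exact p.norm_sum_mul_inv_pivMat_le_of_det_exchange_le F (hP (k + 1) (Nat.succ_pos k) hk)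
      (hdom _ (length_pfx₃ s (k + 1))) u
  · have hM₀ : 0 ≤ M := (norm_nonneg _).trans (hM s)
    calc ‖∑ y, (F (pfx (e y) (p.n + 1)) - p.tciEval F (e y)) * (p.pivMat F (k + 1))⁻¹ y u‖
        ≤ ∑ y, ‖(F (pfx (e y) (p.n + 1)) - p.tciEval F (e y)) * (p.pivMat F (k + 1))⁻¹ y u‖ :=
          norm_sum_le _ _
      _ ≤ ∑ _y : Fin (p.χ (k + 1)), M * β := Finset.sum_le_sum fun y _ => by
          rw [norm_mul]
          exact mul_le_mul (hM (e y)) (hβ y u) (norm_nonneg _) hM₀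
      _ = p.χ (k + 1) * (β * M) := by
          rw [Finset.sum_const, Finset.card_univ, Fintype.card_fin, nsmul_eq_mul, mul_comm M β]

/-- FIRST-ORDER STRUCTURE OF THE BOUND: if `‖(leftProd k)_u‖ ≤ Λ_k` and the full-unfolding cross
errors met by the configuration satisfy `‖Ê_{k+1}(row k u ⊕ s k ; s_{>k})‖ ≤ η_{k+1}` for the
bonds `k < n`, then `‖A(s) - Ã(s)‖ ≤ Σ_{k<n} χ_k Λ_k η_{k+1}` — the error is at most the sum over
the inner bonds of the full-unfolding cross errors, weighted by the size of the left factors.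
[cite: Savostyanov2014, §4, proof of Thm. 3] -/
theorem norm_sub_tciEval_le_sum_of_leftProd_le (s : ℕ → σ) {Λ η : ℕ → ℝ}
    (hΛ : ∀ k, k < p.n → ∀ u, ‖p.leftProd F s k p.rowZero u‖ ≤ Λ k)
    (hη : ∀ k, k < p.n → ∀ u : Fin (p.χ k),
      ‖p.hatErr F (k + 1) (p.row k u ++ [s k]) (sfx s (k + 1) (p.n - k))‖ ≤ η (k + 1)) :
    ‖F (pfx s (p.n + 1)) - p.tciEval F s‖ ≤
      ∑ k ∈ Finset.range p.n, p.χ k * (Λ k * η (k + 1)) := by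
  rw [sub_tciEval_eq_sum_leftProd_mul_hatErr]
  refine (norm_sum_le _ _).trans (Finset.sum_le_sum fun k hk => ?_)
  have hk' : k < p.n := Finset.mem_range.mp hk
  calc ‖∑ u, p.leftProd F s k p.rowZero u *
          p.hatErr F (k + 1) (p.row k u ++ [s k]) (sfx s (k + 1) (p.n - k))‖
      ≤ ∑ u, ‖p.leftProd F s k p.rowZero u *
          p.hatErr F (k + 1) (p.row k u ++ [s k]) (sfx s (k + 1) (p.n - k))‖ := norm_sum_le _ _
    _ ≤ ∑ _u : Fin (p.χ k), Λ k * η (k + 1) := Finset.sum_le_sum fun u _ => by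
        rw [norm_mul]
        exact mul_le_mul (hΛ k hk' u) (hη k hk' u) (norm_nonneg _)
          ((norm_nonneg _).trans (hΛ k hk' u))
    _ = p.χ k * (Λ k * η (k + 1)) := by simp

/-- THE IMPLICIT BOUND OF THE PROOF OF THEOREM 3 (any normed field): suppose the column pivots
are right-nested at the inner bonds `1 ≤ ℓ ≤ n`, every `P_ℓ` is nonsingular and `c`-row-dominant
among the rows of the `ℓ`-th unfolding, `χ_ℓ ≤ r`, `‖(P_ℓ⁻¹)_{y u}‖ ≤ β_ℓ`, the full-unfolding
cross errors satisfy `‖Ê_ℓ‖ ≤ η` on the unfolding `A^{(ℓ)}`, `χ_ℓ β_ℓ η ≤ τ`, and the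
interpolation error is `≤ M` at EVERY configuration.  Then at every configuration
`‖A(s) - Ã(s)‖ ≤ n r (c η + τ M)` — Savostyanov's `|Δ| ≤ d r ε̂ |A| + d r κ ε̂ |Δ|` with
`η = ε̂ |A|`, `τ = κ ε̂`, `c = 1` (and `n = d - 1` inner bonds).
[cite: Savostyanov2014, §4 Thm. 3 (proof)] -/
theorem norm_sub_tciEval_le_of_rowDominant (s : ℕ → σ) {r : ℕ} (hr : 1 ≤ r) {c η τ M : ℝ}
    (hc : 1 ≤ c) (hη₀ : 0 ≤ η) (hτ₀ : 0 ≤ τ) (β : ℕ → ℝ) (hβ₀ : ∀ ℓ, 0 ≤ β ℓ)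
    (hP : ∀ ℓ, 1 ≤ ℓ → ℓ ≤ p.n → IsUnit (p.pivMat F ℓ).det)
    (hJ : ∀ ℓ, 1 ≤ ℓ → ℓ ≤ p.n → p.ColNested ℓ)
    (hdom : ∀ ℓ, 1 ≤ ℓ → ℓ ≤ p.n → ∀ i : List σ, i.length = ℓ → ∀ u : Fin (p.χ ℓ),
      ‖((unfoldingKernel F).submatrix (Function.update (p.row ℓ) u i) (p.col ℓ)).det‖ ≤
        c * ‖(p.pivMat F ℓ).det‖)
    (hχ : ∀ ℓ, 1 ≤ ℓ → ℓ ≤ p.n → p.χ ℓ ≤ r)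
    (hβ : ∀ ℓ, 1 ≤ ℓ → ℓ ≤ p.n → ∀ y u, ‖(p.pivMat F ℓ)⁻¹ y u‖ ≤ β ℓ)
    (hη : ∀ ℓ, 1 ≤ ℓ → ℓ ≤ p.n → ∀ i j : List σ, i.length = ℓ → j.length = p.n + 1 - ℓ →
      ‖p.hatErr F ℓ i j‖ ≤ η)
    (hτ : ∀ ℓ, 1 ≤ ℓ → ℓ ≤ p.n → (p.χ ℓ : ℝ) * β ℓ * η ≤ τ)
    (hM : ∀ s' : ℕ → σ, ‖F (pfx s' (p.n + 1)) - p.tciEval F s'‖ ≤ M) :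
    ‖F (pfx s (p.n + 1)) - p.tciEval F s‖ ≤ p.n * (r * (c * η + τ * M)) := by
  have hM₀ : 0 ≤ M := (norm_nonneg _).trans (hM s)
  have hc₀ : 0 ≤ c := zero_le_one.trans hc
  have hr₁ : (1 : ℝ) ≤ r := by exact_mod_cast hr
  have hr₀ : (0 : ℝ) ≤ r := Nat.cast_nonneg r
  have hΛ : ∀ k, k < p.n → ∀ u, ‖p.leftProd F s k p.rowZero u‖ ≤
      (if k = 0 then (1 : ℝ) else c + p.χ k * (β k * M)) := by
    intro k hk u
    cases k with
    | zero =>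
        rw [if_pos rfl]
        exact (p.norm_leftProd_zero_apply F s u).le
    | succ k =>
        rw [if_neg (show k + 1 ≠ 0 by omega)]
        exact p.norm_leftProd_succ_apply_le F s hP hk.le (fun ℓ h₁ h₂ => hJ ℓ (by omega) h₂)
          (hdom (k + 1) (Nat.succ_pos k) hk.le) (hβ (k + 1) (Nat.succ_pos k) hk.le) hM u
  have h := p.norm_sub_tciEval_le_sum_of_leftProd_le F s (η := fun _ => η) hΛ
    (fun k hk u => hη (k + 1) (Nat.succ_pos k) hk _ _ (by simp [p.length_row])
      (by rw [length_sfx₃]; omega))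
  have hterm : ∀ k ∈ Finset.range p.n,
      (p.χ k : ℝ) * ((if k = 0 then (1 : ℝ) else c + p.χ k * (β k * M)) * η) ≤
        r * (c * η + τ * M) := by
    intro k hk
    have hk' : k < p.n := Finset.mem_range.mp hk
    cases k with
    | zero =>
        rw [if_pos rfl, p.χ_zero, Nat.cast_one, one_mul, one_mul]
        calc η ≤ c * η := le_mul_of_one_le_left hη₀ hc
          _ ≤ r * (c * η) := le_mul_of_one_le_left (mul_nonneg hc₀ hη₀) hr₁
          _ ≤ r * (c * η + τ * M) :=
            mul_le_mul_of_nonneg_left (le_add_of_nonneg_right (mul_nonneg hτ₀ hM₀)) hr₀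
    | succ k =>
        rw [if_neg (show k + 1 ≠ 0 by omega)]
        have hχ' : (p.χ (k + 1) : ℝ) ≤ r := by exact_mod_cast hχ (k + 1) (Nat.succ_pos k) hk'.le
        have hτ' := hτ (k + 1) (Nat.succ_pos k) hk'.le
        have hβ' := hβ₀ (k + 1)
        have hχ₀ : (0 : ℝ) ≤ p.χ (k + 1) := Nat.cast_nonneg _
        have e1 : (p.χ (k + 1) : ℝ) * ((c + p.χ (k + 1) * (β (k + 1) * M)) * η) =
            p.χ (k + 1) * (c * η) + p.χ (k + 1) * ((p.χ (k + 1) * β (k + 1) * η) * M) := by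
          ring
        rw [e1, mul_add]
        refine add_le_add (mul_le_mul_of_nonneg_right hχ' (mul_nonneg hc₀ hη₀)) ?_
        exact mul_le_mul hχ' (mul_le_mul_of_nonneg_right hτ' hM₀)
          (mul_nonneg (mul_nonneg (mul_nonneg hχ₀ hβ') hη₀) hM₀) hr₀
  refine h.trans ((Finset.sum_le_sum hterm).trans (le_of_eq ?_))
  rw [Finset.sum_const, Finset.card_range, nsmul_eq_mul]

end Normed

/-! ### Savostyanov's Theorem 3 (real tensors, finitely many leg values) -/

section Real

variable (F : List σ → ℝ)

/-- On finitely many leg values the interpolation error attains its supremum over all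
configurations (it depends on `s 0, …, s n` only).  [folklore] -/
private theorem exists_max_abs_sub_tciEval [Fintype σ] (d : σ) :
    ∃ s₀ : ℕ → σ, ∀ s : ℕ → σ,
      |F (pfx s (p.n + 1)) - p.tciEval F s| ≤ |F (pfx s₀ (p.n + 1)) - p.tciEval F s₀| := by
  haveI : Nonempty (Fin (p.n + 1) → σ) := ⟨fun _ => d⟩
  obtain ⟨v₀, hv₀⟩ := Finite.exists_max fun v : Fin (p.n + 1) → σ =>
    |F (pfx (extSeq d v) (p.n + 1)) - p.tciEval F (extSeq d v)|
  refine ⟨extSeq d v₀, fun s => ?_⟩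
  have hs : ∀ j ≤ p.n, s j = extSeq d (fun i : Fin (p.n + 1) => s i) j :=
    fun j hj => (extSeq_restrict d s (Nat.lt_succ_of_le hj)).symm
  rw [pfx_congr₃ (p.n + 1) (fun j hj => hs j (Nat.lt_succ_iff.mp hj)), p.tciEval_congr F hs]
  exact hv₀ _

/-- SAVOSTYANOV'S THEOREM 3 for real tensors with finitely many leg values, legs `0, …, n`
(`d = n+1`).  Under the hypotheses of Theorem 2 — right-nested column pivots with witnesses `c`
(`col ℓ t = (c ℓ t).1 ⊕ col (ℓ+1) (c ℓ t).2`, `J_{ℓ+1} ⊆ 𝕊_ℓ × J_{ℓ+2}`), every inner pivot matrix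
`P_ℓ` nonsingular and of MAXIMAL VOLUME in the sub-unfolding `[A(i_{<ℓ} ; 𝕊_ℓ × J_{ℓ+2})]`,
`χ_ℓ ≤ r` (`1 ≤ ℓ ≤ n`, `1 ≤ r`) — suppose the cross interpolations of the FULL unfoldings on the
same crosses have Chebyshev error `|Ê_ℓ| ≤ η` (eq. ihat), `|(P_ℓ⁻¹)_{y u}| ≤ β_ℓ` and
`χ_ℓ β_ℓ η ≤ τ` with `n r τ < 1`.  Then at every configuration
`|A(s) - Ã(s)| ≤ n r η / (1 - n r τ)`.
(With `η = ε̂ |A|` and `κ ≥ χ_ℓ |A| |P_ℓ⁻¹|`, `τ = κ ε̂`, this is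
`|A - Ã| ≤ (d-1) r ε̂ |A| / (1 - (d-1) r κ ε̂)`, see the `_rel` corollaries.)
[cite: Savostyanov2014, §4 Thm. 3][cite: DolgovSavostyanov2020, §3.2] -/
theorem abs_sub_tciEval_le_of_volume_maximal_of_hatErr_le [Fintype σ] {r : ℕ} (hr : 1 ≤ r)
    {η τ : ℝ} (hη₀ : 0 ≤ η) (hτ₀ : 0 ≤ τ) (β : ℕ → ℝ) (hβ₀ : ∀ ℓ, 0 ≤ β ℓ)
    (c : (ℓ : ℕ) → Fin (p.χ ℓ) → σ × Fin (p.χ (ℓ + 1)))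
    (hc : ∀ ℓ, 1 ≤ ℓ → ℓ ≤ p.n → ∀ t, p.col ℓ t = (c ℓ t).1 :: p.col (ℓ + 1) (c ℓ t).2)
    (hP : ∀ ℓ, 1 ≤ ℓ → ℓ ≤ p.n → IsUnit (p.pivMat F ℓ).det)
    (hmax : ∀ ℓ, 1 ≤ ℓ → ℓ ≤ p.n →
      ∀ (r' : Fin (p.χ ℓ) → List.Vector σ ℓ) (c' : Fin (p.χ ℓ) → σ × Fin (p.χ (ℓ + 1))),
        |((p.subUnfolding F ℓ).submatrix r' c').det| ≤ |(p.pivMat F ℓ).det|)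
    (hχ : ∀ ℓ, 1 ≤ ℓ → ℓ ≤ p.n → p.χ ℓ ≤ r)
    (hβ : ∀ ℓ, 1 ≤ ℓ → ℓ ≤ p.n → ∀ y u, |(p.pivMat F ℓ)⁻¹ y u| ≤ β ℓ)
    (hη : ∀ ℓ, 1 ≤ ℓ → ℓ ≤ p.n → ∀ i j : List σ, i.length = ℓ → j.length = p.n + 1 - ℓ →
      |p.hatErr F ℓ i j| ≤ η)
    (hτ : ∀ ℓ, 1 ≤ ℓ → ℓ ≤ p.n → (p.χ ℓ : ℝ) * β ℓ * η ≤ τ)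
    (hθ : (p.n : ℝ) * (r * τ) < 1) (s : ℕ → σ) :
    |F (pfx s (p.n + 1)) - p.tciEval F s| ≤ p.n * (r * η) / (1 - p.n * (r * τ)) := by
  obtain ⟨s₀, hs₀⟩ := p.exists_max_abs_sub_tciEval F (s 0)
  have hJ : ∀ ℓ, 1 ≤ ℓ → ℓ ≤ p.n → p.ColNested ℓ := fun ℓ h₁ h₂ t =>
    ⟨(c ℓ t).2, (c ℓ t).1, hc ℓ h₁ h₂ t⟩
  have hdom : ∀ ℓ, 1 ≤ ℓ → ℓ ≤ p.n → ∀ i : List σ, i.length = ℓ → ∀ u : Fin (p.χ ℓ),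
      ‖((unfoldingKernel F).submatrix (Function.update (p.row ℓ) u i) (p.col ℓ)).det‖ ≤
        1 * ‖(p.pivMat F ℓ).det‖ := by
    intro ℓ h₁ h₂ i hi u
    rw [one_mul, Real.norm_eq_abs, Real.norm_eq_abs,
      p.submatrix_unfoldingKernel_update_row_eq F (hc ℓ h₁ h₂) u i hi]
    exact hmax ℓ h₁ h₂ _ _
  have hM : |F (pfx s₀ (p.n + 1)) - p.tciEval F s₀| ≤
      p.n * (r * (1 * η + τ * |F (pfx s₀ (p.n + 1)) - p.tciEval F s₀|)) := by
    have h := p.norm_sub_tciEval_le_of_rowDominant F s₀ hr le_rfl hη₀ hτ₀ β hβ₀ hP hJ hdom hχ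
      (fun ℓ h₁ h₂ y u => by rw [Real.norm_eq_abs]; exact hβ ℓ h₁ h₂ y u)
      (fun ℓ h₁ h₂ i j hi hj => by rw [Real.norm_eq_abs]; exact hη ℓ h₁ h₂ i j hi hj) hτ
      (fun s' => by rw [Real.norm_eq_abs]; exact hs₀ s')
    rwa [Real.norm_eq_abs] at h
  set M := |F (pfx s₀ (p.n + 1)) - p.tciEval F s₀| with hMdef
  have hM' : M ≤ p.n * (r * η) + p.n * (r * τ) * M := by
    calc M ≤ p.n * (r * (1 * η + τ * M)) := hM
      _ = p.n * (r * η) + p.n * (r * τ) * M := by ring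
  have hpos : 0 < 1 - p.n * (r * τ) := sub_pos.mpr hθ
  have key : M ≤ p.n * (r * η) / (1 - p.n * (r * τ)) := by
    rw [le_div_iff₀ hpos]
    have e : M * (1 - p.n * (r * τ)) = M - p.n * (r * τ) * M := by ring
    rw [e]
    linarith
  exact (hs₀ s).trans key

/-- THEOREM 3 IN THE PRINTED RELATIVE FORM (with the `d - 1 = n` inner bonds): under the
hypotheses of Theorem 2, if the full-unfolding cross errors satisfy `|Ê_ℓ| ≤ ε̂ · |A|` and
`κ ≥ χ_ℓ |A| |(P_ℓ⁻¹)_{y u}|` (Savostyanov's `κ = max_k r_k |A| |A_k⁻¹|`, (eq1)) with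
`(d-1) r κ ε̂ < 1`, then `|A(s) - Ã(s)| ≤ (d-1) r ε̂ / (1 - (d-1) r κ ε̂) · |A|` at every
configuration.  Here `|A|` is any number `A ≥ 0` for which these two hypotheses hold (in the paper,
the Chebyshev norm of the tensor).
[cite: Savostyanov2014, §4 Thm. 3 eq. (e3) and (eq1)][cite: DolgovSavostyanov2020, §3.2] -/
theorem abs_sub_tciEval_le_of_volume_maximal_of_hatErr_le_rel [Fintype σ] {r : ℕ} (hr : 1 ≤ r)
    {ε A κ : ℝ} (hε₀ : 0 ≤ ε) (hA₀ : 0 ≤ A) (hκ₀ : 0 ≤ κ) (β : ℕ → ℝ) (hβ₀ : ∀ ℓ, 0 ≤ β ℓ)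
    (c : (ℓ : ℕ) → Fin (p.χ ℓ) → σ × Fin (p.χ (ℓ + 1)))
    (hc : ∀ ℓ, 1 ≤ ℓ → ℓ ≤ p.n → ∀ t, p.col ℓ t = (c ℓ t).1 :: p.col (ℓ + 1) (c ℓ t).2)
    (hP : ∀ ℓ, 1 ≤ ℓ → ℓ ≤ p.n → IsUnit (p.pivMat F ℓ).det)
    (hmax : ∀ ℓ, 1 ≤ ℓ → ℓ ≤ p.n →
      ∀ (r' : Fin (p.χ ℓ) → List.Vector σ ℓ) (c' : Fin (p.χ ℓ) → σ × Fin (p.χ (ℓ + 1))),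
        |((p.subUnfolding F ℓ).submatrix r' c').det| ≤ |(p.pivMat F ℓ).det|)
    (hχ : ∀ ℓ, 1 ≤ ℓ → ℓ ≤ p.n → p.χ ℓ ≤ r)
    (hβ : ∀ ℓ, 1 ≤ ℓ → ℓ ≤ p.n → ∀ y u, |(p.pivMat F ℓ)⁻¹ y u| ≤ β ℓ)
    (hε : ∀ ℓ, 1 ≤ ℓ → ℓ ≤ p.n → ∀ i j : List σ, i.length = ℓ → j.length = p.n + 1 - ℓ →
      |p.hatErr F ℓ i j| ≤ ε * A)
    (hκ : ∀ ℓ, 1 ≤ ℓ → ℓ ≤ p.n → (p.χ ℓ : ℝ) * A * β ℓ ≤ κ)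
    (hθ : (p.n : ℝ) * r * κ * ε < 1) (s : ℕ → σ) :
    |F (pfx s (p.n + 1)) - p.tciEval F s| ≤ p.n * r * ε / (1 - p.n * r * κ * ε) * A := by
  have hτ : ∀ ℓ, 1 ≤ ℓ → ℓ ≤ p.n → (p.χ ℓ : ℝ) * β ℓ * (ε * A) ≤ κ * ε := fun ℓ h₁ h₂ => by
    calc (p.χ ℓ : ℝ) * β ℓ * (ε * A) = (p.χ ℓ * A * β ℓ) * ε := by ring
      _ ≤ κ * ε := mul_le_mul_of_nonneg_right (hκ ℓ h₁ h₂) hε₀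
  have hθ' : (p.n : ℝ) * (r * (κ * ε)) < 1 := by
    calc (p.n : ℝ) * (r * (κ * ε)) = p.n * r * κ * ε := by ring
      _ < 1 := hθ
  have h := p.abs_sub_tciEval_le_of_volume_maximal_of_hatErr_le F hr (mul_nonneg hε₀ hA₀)
    (mul_nonneg hκ₀ hε₀) β hβ₀ c hc hP hmax hχ hβ hε hτ hθ' s
  calc |F (pfx s (p.n + 1)) - p.tciEval F s| ≤ p.n * (r * (ε * A)) / (1 - p.n * (r * (κ * ε))) := h
    _ = p.n * r * ε / (1 - p.n * r * κ * ε) * A := by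
        rw [div_mul_eq_mul_div]
        congr 1 <;> ring

/-- THEOREM 3 LITERALLY AS PRINTED, with the coefficient `d = n + 1` (the number of legs) in place
of the `d - 1` inner bonds: `|A - Ã| ≤ d r ε̂ / (1 - d r κ ε̂) · |A|` provided `d r κ ε̂ < 1`.
[cite: Savostyanov2014, §4 Thm. 3 eq. (e3)] -/
theorem abs_sub_tciEval_le_of_volume_maximal_of_hatErr_le_rel' [Fintype σ] {r : ℕ} (hr : 1 ≤ r)
    {ε A κ : ℝ} (hε₀ : 0 ≤ ε) (hA₀ : 0 ≤ A) (hκ₀ : 0 ≤ κ) (β : ℕ → ℝ) (hβ₀ : ∀ ℓ, 0 ≤ β ℓ)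
    (c : (ℓ : ℕ) → Fin (p.χ ℓ) → σ × Fin (p.χ (ℓ + 1)))
    (hc : ∀ ℓ, 1 ≤ ℓ → ℓ ≤ p.n → ∀ t, p.col ℓ t = (c ℓ t).1 :: p.col (ℓ + 1) (c ℓ t).2)
    (hP : ∀ ℓ, 1 ≤ ℓ → ℓ ≤ p.n → IsUnit (p.pivMat F ℓ).det)
    (hmax : ∀ ℓ, 1 ≤ ℓ → ℓ ≤ p.n →
      ∀ (r' : Fin (p.χ ℓ) → List.Vector σ ℓ) (c' : Fin (p.χ ℓ) → σ × Fin (p.χ (ℓ + 1))),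
        |((p.subUnfolding F ℓ).submatrix r' c').det| ≤ |(p.pivMat F ℓ).det|)
    (hχ : ∀ ℓ, 1 ≤ ℓ → ℓ ≤ p.n → p.χ ℓ ≤ r)
    (hβ : ∀ ℓ, 1 ≤ ℓ → ℓ ≤ p.n → ∀ y u, |(p.pivMat F ℓ)⁻¹ y u| ≤ β ℓ)
    (hε : ∀ ℓ, 1 ≤ ℓ → ℓ ≤ p.n → ∀ i j : List σ, i.length = ℓ → j.length = p.n + 1 - ℓ →
      |p.hatErr F ℓ i j| ≤ ε * A)
    (hκ : ∀ ℓ, 1 ≤ ℓ → ℓ ≤ p.n → (p.χ ℓ : ℝ) * A * β ℓ ≤ κ)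
    (hθ : ((p.n : ℝ) + 1) * r * κ * ε < 1) (s : ℕ → σ) :
    |F (pfx s (p.n + 1)) - p.tciEval F s| ≤
      ((p.n : ℝ) + 1) * r * ε / (1 - ((p.n : ℝ) + 1) * r * κ * ε) * A := by
  have hr₀ : (0 : ℝ) ≤ r := Nat.cast_nonneg r
  have hn₀ : (0 : ℝ) ≤ p.n := Nat.cast_nonneg p.n
  have hrκε : 0 ≤ (r : ℝ) * κ * ε := mul_nonneg (mul_nonneg hr₀ hκ₀) hε₀
  have hθn : (p.n : ℝ) * r * κ * ε < 1 := by
    calc (p.n : ℝ) * r * κ * ε = p.n * (r * κ * ε) := by ring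
      _ ≤ (p.n + 1) * (r * κ * ε) := mul_le_mul_of_nonneg_right (by linarith) hrκε
      _ = (p.n + 1) * r * κ * ε := by ring
      _ < 1 := hθ
  have h := p.abs_sub_tciEval_le_of_volume_maximal_of_hatErr_le_rel F hr hε₀ hA₀ hκ₀ β hβ₀ c hc
    hP hmax hχ hβ hε hκ hθn s
  refine h.trans ?_
  rw [div_mul_eq_mul_div, div_mul_eq_mul_div]
  have hpos : 0 < 1 - ((p.n : ℝ) + 1) * r * κ * ε := sub_pos.mpr hθ
  refine div_le_div₀ ?_ ?_ hpos ?_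
  · exact mul_nonneg (mul_nonneg (mul_nonneg (by linarith) hr₀) hε₀) hA₀
  · have : (p.n : ℝ) * r * ε * A = p.n * (r * ε * A) := by ring
    have h2 : ((p.n : ℝ) + 1) * r * ε * A = (p.n + 1) * (r * ε * A) := by ring
    rw [this, h2]
    exact mul_le_mul_of_nonneg_right (by linarith) (mul_nonneg (mul_nonneg hr₀ hε₀) hA₀)
  · have : (p.n : ℝ) * r * κ * ε = p.n * (r * κ * ε) := by ring
    have h2 : ((p.n : ℝ) + 1) * r * κ * ε = (p.n + 1) * (r * κ * ε) := by ring
    rw [this, h2]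
    linarith [mul_le_mul_of_nonneg_right (show (p.n : ℝ) ≤ p.n + 1 by linarith) hrκε]

end Real

end TCIPivots

end Literature.LinearAlgebra.TensorNetworks
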